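import Summits.SmoothPoincare4.SmoothPoincare4.Theses.CongruenceShadows
import Literature.Topology.FourManifolds.SurfaceGroupGenusOne

/-!
# `HeegaardHandlebodyCongruenceClosed` (crux `stmt-SmoothPoincare4-14596`, route `CongruenceShadows`):
# negative-side support — which families of levels do NOT suffice (cdisprove seat, sorry-free)

The crux `Summit.SmoothPoincare4.SmoothPoincare4.Theses.CongruenceShadows.HeegaardHandlebodyCongruenceClosed`
says that, with `S = S_{3+3m}`, `N = s4Kernels.stabilizeIter m`, `A∩B = Stab N₀ ∩ Stab N₁`, `C = Stab N₂`
(subgroups of `Aut S`) and `K_M = ker (Aut S → Aut (S/M))`, the product set `P = (A∩B)·C` is closed in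
the congruence topology: `⋂_{M char., f.i.} P·K_M = P`. Nothing in these files defines a proposition
under `Summits/`: `gate m : Set (Aut S)` and `gateMod m M : Set (Aut S)` are the SETS `P` and `P·K_M`
(the crux is literally `∀ m ρ, (∀ M char f.i., ρ ∈ gateMod m M) → ρ ∈ gate m`, `crux_iff`), the
witnesses are definitions (automorphisms of `S₃`, homs to `Sym(3)` / dihedral groups, the subgroup
`M₂`), and every refuted strengthening is written inline in the `¬`-theorem that kills it. No statement
here is the crux or its negation; the crux stays OPEN (it has SPC4 ∧ 4-d-Waldhausen strength on its
locus, see the cdisprove work file `Cruxes/HeegaardHandlebodyCongruenceClosed/Disproof.lean`).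

## Results (this file = 1/5; the rest in `Negative/GenusThreeAutomorphisms`, `OneLevel`,
## `MixingTwists`, `JohnsonKernelWitness`)

* ANATOMY (all `m`): `tripleJoin_eq_top_of_inGate` / `tripleJoin_sup_eq_top_of_inGateMod` — a gate
  element has trivial twisted triple quotient `S/(N₀ N₁ ρN₂)`, and an element of `P·K_M` (`M` normal)
  has `(N₀ ⊔ N₁ ⊔ ρN₂) ⊔ M = ⊤`; so a counterexample to the crux carries a kernel triple whose triple
  quotient is profinitely trivial (exotic-`S⁴` / 4-d-Waldhausen / Higman-sphere type).
* `heegaardHandlebodyCongruenceClosed_holds_without_finiteIndex` — with `FiniteIndex` dropped from the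
  `M`-family the crux is trivially true (`M = ⊥`): its content is the restriction to finite-index levels.
* (3/5) `heegaardHandlebodyCongruenceClosed_conclusion_not_universal` — `P ≠ Aut S₃` (`ρ₀`, the quarter
  rotation of a handle; `S₃ ⧸ (N₁ ⊔ ρ₀N₂) = F₂`).
* (3/5) `…_false_with_one_level` / `…_false_with_level_two` / `…_false_with_any_one_level` — ONE level
  never suffices: not the mod-2 homology level `M₂` (`ρ₁ = T_c²`, `T_c` the twist about the `(1,1)`-curve
  of a handle, is `≡ id (mod M₂)` but gives `L(3,1) # S¹×S²`), and uniformly NO level at all (for every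
  characteristic finite-index `M` a power `T_c^{2d} ≡ id (mod M)` lies outside the gate; dihedral
  certificates) — the gate has EMPTY INTERIOR in the congruence topology.
* (5/5) `…_false_with_torelli_congruence` / `…_johnson_congruence` / `…_classTwo_levels` — NO FAMILY OF
  ABELIAN OR CLASS-2-NILPOTENT LEVELS SUFFICES: the separating twist `ρ₂ = ψ ∘ T_{δ₀} ∘ ψ⁻¹`
  (`ψ = T_B ∘ T_A⁻¹`, `T_A`, `T_B` handle-mixing Dehn twists of classes `a₀+a₁`, `b₀+b₁`, found by a
  Whitehead-graph search for the stabiliser of the cyclic word `[a₀,b₀][a₁,b₁]`) satisfies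
  `ρ₂ s · s⁻¹ ∈ γ₃(S₃)` for all `s` (Johnson kernel), hence lies in `P·K_M` with `x = c = 1` for every
  characteristic finite-index `M ⊇ γ₃ S₃`, yet `ρ₂ ∉ P` (certificate into `Sym(3)` through the pair
  `(N₀, ρ₂N₂)`: a homology `S¹×S²` with a `Sym(3)` quotient). MORAL FOR PROVERS: the crux lives at
  nilpotency class ≥ 3 and at non-nilpotent (soluble / simple) levels, simultaneously over all of them;
  compare the (true) abelian shadow statement.
* Certificate engines, reusable by `ShadowsStandard` refuters: `not_inGate_zero_of_cert`,
  `not_inGate_zero_of_cert0` — a hom `S₃ → Q` killing the generators of `N₁` (resp. `N₀`) and of `ρN₂`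
  with two non-commuting values proves `ρ ∉ P`, because `S₃/(N₁ ⊔ N₂)` and `S₃/(N₀ ⊔ N₂)` are `ℤ`.

All free-group identities behind the automorphisms are re-verified by `group`; all finite checks by
`decide` in `Perm (Fin 3)` / `𝔽₂`. Seat computations: `py/whitehead.py`, `py/extract.py` (folder of
`refuter-cdisprove-stmt-SmoothPoincare4-14596-0`). [folklore]
-/

namespace Summit.SmoothPoincare4.SmoothPoincare4.Theorems.HeegaardHandlebodyCongruenceClosed.Negative

open Literature.Topology.FourManifolds Subgroup

/-- `S m = S_{3+3m}`. [folklore] -/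
abbrev S (m : ℕ) : Type := SurfaceGroup (3 + 3 * m)

/-- `N m` = the standard `S⁴` kernel triple of genus `3+3m`. [folklore] -/
abbrev N (m : ℕ) : TrisectionKernels (3 + 3 * m) := s4Kernels.stabilizeIter m

/-- The gate `(Stab N₀ ∩ Stab N₁)·Stab N₂ ⊆ Aut S` as a SET of automorphisms: `ρ = x ∘ c` with `x`
stabilising `N₀` and `N₁` and `c` stabilising `N₂` (verbatim the conclusion of the crux). [folklore] -/
def gate (m : ℕ) : Set (S m ≃* S m) :=
  {ρ | ∃ x c : S m ≃* S m, (N m 0).map x.toMonoidHom = N m 0 ∧ (N m 1).map x.toMonoidHom = N m 1 ∧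
    (N m 2).map c.toMonoidHom = N m 2 ∧ ∀ s, ρ s = x (c s)}

/-- The level-`M` thickening `(Stab N₀ ∩ Stab N₁)·Stab N₂·K_M` of the gate: `ρ ≡ x ∘ c (mod M)`
pointwise (verbatim the hypothesis of the crux at one level `M`). [folklore] -/
def gateMod (m : ℕ) (M : Subgroup (S m)) : Set (S m ≃* S m) :=
  {ρ | ∃ x c : S m ≃* S m, (N m 0).map x.toMonoidHom = N m 0 ∧ (N m 1).map x.toMonoidHom = N m 1 ∧
    (N m 2).map c.toMonoidHom = N m 2 ∧ ∀ s, ρ s * (x (c s))⁻¹ ∈ M}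

/-- The crux is literally the closedness of the gate: `∀ m ρ, (∀ M char f.i., ρ ∈ P·K_M) → ρ ∈ P`. [folklore] -/
theorem crux_iff :
    Theses.CongruenceShadows.HeegaardHandlebodyCongruenceClosed ↔
      ∀ (m : ℕ) (ρ : S m ≃* S m),
        (∀ M : Subgroup (S m), M.Characteristic → M.FiniteIndex → ρ ∈ gateMod m M) → ρ ∈ gate m :=
  Iff.rfl

/-- The standard triple is a group trisection of the trivial group at every genus `3+3m`. [folklore] -/
theorem N_isGroupTrisection (m : ℕ) : IsGroupTrisection (3 + 3 * m) (m + 1) (PUnit : Type) (N m) := by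
  induction m with
  | zero => exact s4Kernels_isGroupTrisection_holds
  | succ m ih => exact stabilize_isGroupTrisection_holds _ _ _ _ ih

/-- instance `N_normal` (see the module docstring). [folklore] -/
instance N_normal (m : ℕ) (i : Fin 3) : (N m i).Normal := (N_isGroupTrisection m).normal i

/-- The triple join of the standard kernels is everything (triple quotient trivial). [folklore] -/
theorem normalClosure_iUnion_N (m : ℕ) : normalClosure (⋃ i, (N m i : Set (S m))) = ⊤ := by
  obtain ⟨e⟩ := (N_isGroupTrisection m).triple
  haveI : Subsingleton (N m).tripleQuotient := e.toEquiv.subsingleton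
  rw [eq_top_iff]
  intro g _
  exact (QuotientGroup.eq_one_iff g).1 (Subsingleton.elim _ _)

/-- `map` along a composite automorphism. [folklore] -/
theorem map_trans {m : ℕ} (H : Subgroup (S m)) (e₁ e₂ : S m ≃* S m) :
    H.map (e₁.trans e₂).toMonoidHom = (H.map e₁.toMonoidHom).map e₂.toMonoidHom := by
  rw [Subgroup.map_map]; rfl

/-- instance `map_N_normal` (see the module docstring). [folklore] -/
instance map_N_normal (m : ℕ) (i : Fin 3) (ρ : S m ≃* S m) : ((N m i).map ρ.toMonoidHom).Normal :=
  Subgroup.Normal.map inferInstance _ ρ.surjective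

/-- gate membership as a statement about the image of `N₂`. [folklore] -/
theorem inGate_iff (m : ℕ) (ρ : S m ≃* S m) :
    ρ ∈ gate m ↔ ∃ x : S m ≃* S m, (N m 0).map x.toMonoidHom = N m 0 ∧ (N m 1).map x.toMonoidHom = N m 1 ∧
      (N m 2).map x.toMonoidHom = (N m 2).map ρ.toMonoidHom := by
  constructor
  · rintro ⟨x, c, h0, h1, h2, h⟩
    refine ⟨x, h0, h1, ?_⟩
    have hρ : ρ = c.trans x := MulEquiv.ext fun s => by simpa using h s
    rw [hρ, map_trans, h2]
  · rintro ⟨x, h0, h1, h2⟩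
    refine ⟨x, ρ.trans x.symm, h0, h1, ?_, fun s => by simp⟩
    show (N m 2).map (ρ.trans x.symm).toMonoidHom = N m 2
    rw [map_trans, ← h2, ← map_trans]
    simp

/-- pointwise congruence moves the image of `N₂` only within `M`. [folklore] -/
theorem map_sup_eq_of_congr {m : ℕ} {ρ x c : S m ≃* S m} {M : Subgroup (S m)}
    (h : ∀ s, ρ s * (x (c s))⁻¹ ∈ M) (H : Subgroup (S m)) :
    H.map ρ.toMonoidHom ⊔ M = (H.map c.toMonoidHom).map x.toMonoidHom ⊔ M := by
  apply le_antisymm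
  · refine sup_le ?_ le_sup_right
    rintro _ ⟨s, hs, rfl⟩
    have : ρ s = (ρ s * (x (c s))⁻¹) * x (c s) := by group
    rw [MulEquiv.coe_toMonoidHom, this]
    exact mul_mem (mem_sup_right (h s)) (mem_sup_left ⟨c s, ⟨s, hs, rfl⟩, rfl⟩)
  · refine sup_le ?_ le_sup_right
    rintro _ ⟨_, ⟨s, hs, rfl⟩, rfl⟩
    have : x (c s) = (ρ s * (x (c s))⁻¹)⁻¹ * ρ s := by group
    rw [MulEquiv.coe_toMonoidHom, MulEquiv.coe_toMonoidHom, this]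
    exact mul_mem (mem_sup_right (inv_mem (h s))) (mem_sup_left ⟨s, hs, rfl⟩)

/-- the normal closure of the twisted triple [folklore] -/
abbrev tripleJoin (m : ℕ) (ρ : S m ≃* S m) : Subgroup (S m) :=
  N m 0 ⊔ N m 1 ⊔ (N m 2).map ρ.toMonoidHom

/-- helper lemma `tripleJoin_eq_top_of_carrier` (see the module docstring). [folklore] -/
theorem tripleJoin_eq_top_of_carrier {m : ℕ} {ρ x : S m ≃* S m} (h0 : (N m 0).map x.toMonoidHom = N m 0) (h1 : (N m 1).map x.toMonoidHom = N m 1)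
    (h2 : (N m 2).map x.toMonoidHom = (N m 2).map ρ.toMonoidHom) : tripleJoin m ρ = ⊤ := by
  have hx : Function.Surjective x.toMonoidHom := x.surjective
  have key : (⊤ : Subgroup (S m)).map x.toMonoidHom ≤ tripleJoin m ρ := by
    rw [← normalClosure_iUnion_N m, map_normalClosure _ _ hx]
    refine normalClosure_le_normal ?_
    rintro _ ⟨s, hs, rfl⟩
    simp only [Set.mem_iUnion, SetLike.mem_coe] at hs
    obtain ⟨i, hi⟩ := hs
    fin_cases i
    · exact mem_sup_left (mem_sup_left (h0.le ⟨s, hi, rfl⟩))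
    · exact mem_sup_left (mem_sup_right (h1.le ⟨s, hi, rfl⟩))
    · exact mem_sup_right (h2.le ⟨s, hi, rfl⟩)
  rw [eq_top_iff]
  refine le_trans ?_ key
  rw [← MonoidHom.range_eq_map, MonoidHom.range_eq_top.2 hx]

/-- NECESSARY CONDITION 1: a gate element has trivial twisted triple quotient. [folklore] -/
theorem tripleJoin_eq_top_of_inGate {m : ℕ} {ρ : S m ≃* S m} (h : ρ ∈ gate m) : tripleJoin m ρ = ⊤ := by
  obtain ⟨x, h0, h1, h2⟩ := (inGate_iff m ρ).1 h
  exact tripleJoin_eq_top_of_carrier h0 h1 h2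

/-- NECESSARY CONDITION 2: congruent to a gate element mod a normal `M` ⇒ triple quotient dies mod `M`. [folklore] -/
theorem tripleJoin_sup_eq_top_of_inGateMod {m : ℕ} {ρ : S m ≃* S m} {M : Subgroup (S m)} [M.Normal]
    (h : ρ ∈ gateMod m M) : tripleJoin m ρ ⊔ M = ⊤ := by
  obtain ⟨x, c, h0, h1, h2, h⟩ := h
  have hx : Function.Surjective x.toMonoidHom := x.surjective
  have e2 : (N m 2).map ρ.toMonoidHom ⊔ M = (N m 2).map x.toMonoidHom ⊔ M := by
    rw [map_sup_eq_of_congr h, h2]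
  have key : (⊤ : Subgroup (S m)).map x.toMonoidHom ≤ tripleJoin m ρ ⊔ M := by
    rw [← normalClosure_iUnion_N m, map_normalClosure _ _ hx]
    refine normalClosure_le_normal ?_
    rintro _ ⟨s, hs, rfl⟩
    simp only [Set.mem_iUnion, SetLike.mem_coe] at hs
    obtain ⟨i, hi⟩ := hs
    fin_cases i
    · exact mem_sup_left (mem_sup_left (mem_sup_left (h0.le ⟨s, hi, rfl⟩)))
    · exact mem_sup_left (mem_sup_left (mem_sup_right (h1.le ⟨s, hi, rfl⟩)))
    · have : x.toMonoidHom s ∈ (N m 2).map ρ.toMonoidHom ⊔ M := by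
        rw [e2]; exact mem_sup_left ⟨s, hi, rfl⟩
      simp only [tripleJoin]
      -- reassociate: (A ⊔ B ⊔ C) ⊔ M ≥ C ⊔ M
      exact (sup_le_sup_right le_sup_right M) this
  rw [eq_top_iff]
  refine le_trans ?_ key
  rw [← MonoidHom.range_eq_map, MonoidHom.range_eq_top.2 hx]

/-- contrapositive certificate: a nontrivial twisted triple quotient keeps `ρ` out of the gate. [folklore] -/
theorem not_inGate_of_tripleJoin_ne_top {m : ℕ} {ρ : S m ≃* S m} (h : tripleJoin m ρ ≠ ⊤) :
    ρ ∉ gate m := fun hρ => h (tripleJoin_eq_top_of_inGate hρ)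

/-- non-vacuity: gate elements satisfy the hypothesis at every `M`. [folklore] -/
theorem inGateMod_of_inGate {m : ℕ} {ρ : S m ≃* S m} (h : ρ ∈ gate m) (M : Subgroup (S m)) :
    ρ ∈ gateMod m M := by
  obtain ⟨x, c, h0, h1, h2, h⟩ := h
  exact ⟨x, c, h0, h1, h2, fun s => by simp [h s]⟩

/-- helper lemma `inGate_refl` (see the module docstring). [folklore] -/
theorem inGate_refl (m : ℕ) : MulEquiv.refl _ ∈ gate m :=
  ⟨MulEquiv.refl _, MulEquiv.refl _, by simp, by simp, by simp, fun s => rfl⟩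

/-- LOAD-BEARING (the `M`-family): the crux with `FiniteIndex` DROPPED (hypothesis over all characteristic
`M`, including `⊥`) holds trivially — all content of the crux sits in the restriction to finite-index
levels. (A weakening of the crux, so this settles nothing about it.) [folklore] -/
theorem heegaardHandlebodyCongruenceClosed_holds_without_finiteIndex :
    ∀ (m : ℕ) (ρ : S m ≃* S m), (∀ M : Subgroup (S m), M.Characteristic → ρ ∈ gateMod m M) →
      ρ ∈ gate m := by
  intro m ρ h
  obtain ⟨x, c, h0, h1, h2, h⟩ := h ⊥ inferInstance
  exact ⟨x, c, h0, h1, h2, fun s => mul_inv_eq_one.1 ((mem_bot).1 (h s))⟩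

/-- Monotonicity in `M`. [folklore] -/
theorem gateMod_mono {m : ℕ} {ρ : S m ≃* S m} {M M' : Subgroup (S m)} (hle : M ≤ M')
    (h : ρ ∈ gateMod m M) : ρ ∈ gateMod m M' := by
  obtain ⟨x, c, h0, h1, h2, h⟩ := h
  exact ⟨x, c, h0, h1, h2, fun s => hle (h s)⟩

end Summit.SmoothPoincare4.SmoothPoincare4.Theorems.HeegaardHandlebodyCongruenceClosed.Negative
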